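/-
Origin: expansion seat `prover-pub-hodgecm-own-htheta-g2-0`, handover #H31 2026-08-21T14:05:49Z md5 7e9c6701e48d (102 l.; NEW additive MODEL leaf — SCHAIN row 2 of 11: face-scope `_S`∕`_gal` twin of `HodgeCM/Model/E2InstanceOG.lean`-class head (scope triple ↦ `S c` ∕ `6 ≤ finrank ℚ c.K ∧ IsNormalClosure ℚ c.K L`); author item6-p2 (prover-pub-hodgecm2-item6-p2-0) under own-htheta; nothing cited beyond the record's binders; NOT an E term; sha256 e43950bb5d2bdfacc513bf35a1f2aaae88719dd8aa65f7a1095f0554bf9fe06d; CERT rc 0 + trio as in the header; NAMES for audit: HodgeCM.Model.thetaRealisation₂_picardCMOG_S ) (`HOME/pub-hodgecm-own-htheta/stage81/HodgeCM/Model/E2InstanceOGS.lean`, md5 7e9c6701e48d, 102 lines);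
landed by the p-seat packager p gen 32 (p-g32) in gate run 80 as `HodgeCM/Model/E2InstanceOGS.lean` (verbatim).
-/
/-
Copyright (c) 2026 the pub-hodgecm formalisation cell (harness21).  New file, not vendored.
Origin: seat `prover-pub-hodgecm2-item6-p2-0` (unit pub-hodgecm2-item6-p2, TRANSPOSITION item (vi) extra prover p2 queued behind the own-htheta
lineage; coordinator ruling 2026-08-21T13:01:49Z), 2026-08-21 — CLAIM pub-hodgecm STATUS 13:45:32Z «SCOPE-PARAMETRIC POINTWISE E-CHAIN `…_S`»
(hodge-director/ITEM6-SPLIT.md (vi-4); x2 `E-HEADS-FACE-BLUEPRINT.md` v1.1 fc085fc795dd §3 step (3)).  Target in PKG: `HodgeCM/Model/E2InstanceOGS.lean`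
(NEW additive leaf beside `HodgeCM/Model/E2InstanceOG.lean`, installed md5 24f2c427c7f3; imports `HodgeCM.Model.E2InstanceOG` + `HodgeCM.Model.EndStateMeetOGS`; nothing of record imports it).
KERNEL ONLY: theorems, no proof holes, nothing cited, no `def`, no hypothesis kind of E; nothing here is a claim of the manuscripts under adjudication;
HC_CM is NOT proved.

WHAT IT IS — layer A9 (stage-0 instance over the facts) of the scope-parametric chain: the `_S` form of `perLCanonical_picardCMOG`.  Statement = the original's VERBATIM except: (1) two new leading
binders `scope : ∀ {L}, SeesawCtx L → Prop`; (2) E's literal scope triple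
`Module.finrank ℚ c.K = 6 ∧ IsNormalClosure ℚ c.K L ∧ (… = 24 ∨ … = 48)` in every slot type ↦ `scope c`; (3) the regime proof terms
`two_lt_finrank_of_goodCtx … hc hK.1` / `isAnisotropic_of_goodCtx … hK.1` / `translOf … hK.1` ↦ x1's `_ge` forms (#H21 `Model/ThetaSpaceInputPinGe.lean`) at
`(hscope c hK)`; (4) the CONCLUSION `U.PerLCanonical` ↦ the POINTWISE one `∀ V c, GoodCtx ι₁ c → scope c → (mk ι₁).embedding = ι₁ →
Nonempty (U.ThetaRealisation₂ ι₁ V c.K c.Ψ c.σ)`; (5) the head call ↦ the `_S` predecessor.  Proof otherwise the original's.  E's layer is NOT re-derived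
from this one (E stays as installed); the two are siblings.  Generated from the installed bytes by `work/gen_schain.py` (edit list `work/gen_schain.report`).
-/
import Summits.HodgeConjecture.HodgeCM.Model.E2InstanceOG
import Summits.HodgeConjecture.HodgeCM.Model.EndStateMeetOGS

/-! PORT of `HodgeCM/Model/E2InstanceOGS.lean` (HodgeCMPerL run 82) — verbatim mechanical port; provenance in the PORT header line. -/

set_option autoImplicit false

noncomputable section

open scoped TensorProduct InnerProductSpace

namespace HodgeCM

namespace Model

open HodgeCM.Universe (AdelicThetaCore AdelicThetaCore₀ SideData ThetaModel ModelAxiomsPerL)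
open Literature.AlgebraicGeometry.HodgeTheory
open Literature.NumberTheory.Automorphic.PicardCM

variable (hHD : exists_isReal_hodgeModel) (hI : hodgePQ_independent_of_hodgeModel)
  (h₁ : BallQuotientUniformised)  (h₃ : CMAbelianVarietyRealised)

/-- `_S` (SCOPE-PARAMETRIC, POINTWISE-CONCLUSION) form of `perLCanonical_picardCMOG`: E's scope triple ↦ a free class `scope c`, regime at `hscope`, conclusion = `ThetaRealisation₂` at every good context of the class. **ORIENTED-FAMILY twin of `perL_picardCM`** (`E2Instance`): the recipe bit per complex place, `h ↦ hb L ι₁` in every binder;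
proof = the source proof over the oriented predecessor. -/
theorem thetaRealisation₂_picardCMOG_S (scope : ∀ {L : CMField}, SeesawCtx L → Prop)
    (hHR : BettiUniverse.HodgeRiemann20) (hb : ∀ L : CMField, (L →+* ℂ) → Bool)
    (emb : ∀ {L : CMField} {ι₁ : L →+* ℂ} {V : HermSpace3 L ι₁} (Γ : Level V),
      (picardCMUniverse hHD hI h₁ h₃).CohC ((picardCMUniverse hHD hI h₁ h₃).pms L ι₁ V Γ) 2 →ₗ[ℂ]
        (V.latticeModel printFact_unitaryCompact_holds).toQuotientModel.H)
    (cover : ∀ {L : CMField} {ι₁ : L →+* ℂ} {V : HermSpace3 L ι₁} (Γ Γ' : Level V),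
      Γ'.Γ ≤ Γ.Γ → (picardCMUniverse hHD hI h₁ h₃).Mor ((picardCMUniverse hHD hI h₁ h₃).pms L ι₁ V Γ')
        ((picardCMUniverse hHD hI h₁ h₃).pms L ι₁ V Γ))
    (wm : ∀ {L : CMField} {ι₁ : L →+* ℂ} (V : HermSpace3 L ι₁) (c : SeesawCtx L),
      WeilThetaModel (V.latticeModel printFact_unitaryCompact_holds).toQuotientModel.G
        (V.latticeModel printFact_unitaryCompact_holds).toQuotientModel.Γ
        (c.D.latticeModelW printFact_unitaryCompact_holds).toQuotientModel.G
        (c.D.latticeModelW printFact_unitaryCompact_holds).toQuotientModel.Γ)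
    (Theta : ∀ {L : CMField} {ι₁ : L →+* ℂ} (V : HermSpace3 L ι₁), SeesawCtx L → Fin 4 → ∀ Γ : Level V,
      Set ((picardCMUniverse hHD hI h₁ h₃).CohC ((picardCMUniverse hHD hI h₁ h₃).pms L ι₁ V Γ) 1))
    (d12 d34 : ∀ {L : CMField}, SeesawCtx L → SideData L)
    (innerEmb : ∀ {L : CMField} {ι₁ : L →+* ℂ} (V : HermSpace3 L ι₁) (c : SeesawCtx L),
      (thetaModelOf hHD hI h₁ h₃ (hb L ι₁) emb cover wm Theta d12 d34).GoodCtx ι₁ c → scope c →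
      (NumberField.InfinitePlace.mk ι₁).embedding = ι₁ →
      (thetaModelOf hHD hI h₁ h₃ (hb L ι₁) emb cover wm Theta d12 d34).InnerEmbAt V)
    (thetaSub : ∀ {L : CMField} {ι₁ : L →+* ℂ} (V : HermSpace3 L ι₁) (c : SeesawCtx L),
      (thetaModelOf hHD hI h₁ h₃ (hb L ι₁) emb cover wm Theta d12 d34).GoodCtx ι₁ c → scope c →
      (NumberField.InfinitePlace.mk ι₁).embedding = ι₁ →
      ∀ (i : Fin 4) (Γ : Level V), (thetaModelOf hHD hI h₁ h₃ (hb L ι₁) emb cover wm Theta d12 d34).Theta V c i Γ ⊆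
        (picardCMUniverse hHD hI h₁ h₃).Uiso Γ c.K (c.Ψ i) c.σ)
    (thetaWedge : ∀ {L : CMField} {ι₁ : L →+* ℂ} (V : HermSpace3 L ι₁) (c : SeesawCtx L),
      (thetaModelOf hHD hI h₁ h₃ (hb L ι₁) emb cover wm Theta d12 d34).GoodCtx ι₁ c → scope c →
      (NumberField.InfinitePlace.mk ι₁).embedding = ι₁ →
      ∃ Γ : Level V, ∃ ω₁ ∈ (thetaModelOf hHD hI h₁ h₃ (hb L ι₁) emb cover wm Theta d12 d34).Theta V c 0 Γ,
        ∃ ω₂ ∈ (thetaModelOf hHD hI h₁ h₃ (hb L ι₁) emb cover wm Theta d12 d34).Theta V c 1 Γ,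
        (picardCMUniverse hHD hI h₁ h₃).cup2C ((picardCMUniverse hHD hI h₁ h₃).pms L ι₁ V Γ) 1 ω₁ ω₂ ≠ 0)
    (gen12 : ∀ {L : CMField} {ι₁ : L →+* ℂ} (V : HermSpace3 L ι₁) (c : SeesawCtx L),
      (thetaModelOf hHD hI h₁ h₃ (hb L ι₁) emb cover wm Theta d12 d34).GoodCtx ι₁ c → scope c →
      (NumberField.InfinitePlace.mk ι₁).embedding = ι₁ →
      Nonempty ((thetaModelOf hHD hI h₁ h₃ (hb L ι₁) emb cover wm Theta d12 d34).Gen12FunBridge V c))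
    (real34 : ∀ {L : CMField} {ι₁ : L →+* ℂ} (V : HermSpace3 L ι₁) (c : SeesawCtx L),
      (thetaModelOf hHD hI h₁ h₃ (hb L ι₁) emb cover wm Theta d12 d34).GoodCtx ι₁ c → scope c →
      (NumberField.InfinitePlace.mk ι₁).embedding = ι₁ →
      Nonempty ((thetaModelOf hHD hI h₁ h₃ (hb L ι₁) emb cover wm Theta d12 d34).Real34FunBridge V c))
    (occ : ∀ {L : CMField} {ι₁ : L →+* ℂ} (V : HermSpace3 L ι₁) (c : SeesawCtx L),
      (thetaModelOf hHD hI h₁ h₃ (hb L ι₁) emb cover wm Theta d12 d34).GoodCtx ι₁ c → scope c →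
      (NumberField.InfinitePlace.mk ι₁).embedding = ι₁ →
      (∀ (Φ : (thetaModelOf hHD hI h₁ h₃ (hb L ι₁) emb cover wm Theta d12 d34).SK V c)
          (i : (thetaModelOf hHD hI h₁ h₃ (hb L ι₁) emb cover wm Theta d12 d34).SigIdx V c),
          (∃ v ∈ ((thetaModelOf hHD hI h₁ h₃ (hb L ι₁) emb cover wm Theta d12 d34).core V c).hatσ i,
              ((thetaModelOf hHD hI h₁ h₃ (hb L ι₁) emb cover wm Theta d12 d34).core V c).TΦ Φ v ≠ 0) →
          ((thetaModelOf hHD hI h₁ h₃ (hb L ι₁) emb cover wm Theta d12 d34).t12 V c).wOccurs i) ∧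
        (∀ (Φ : (thetaModelOf hHD hI h₁ h₃ (hb L ι₁) emb cover wm Theta d12 d34).SK V c)
          (i : (thetaModelOf hHD hI h₁ h₃ (hb L ι₁) emb cover wm Theta d12 d34).SigIdx V c),
          (∃ v ∈ ((thetaModelOf hHD hI h₁ h₃ (hb L ι₁) emb cover wm Theta d12 d34).core V c).hatσ i,
              ((thetaModelOf hHD hI h₁ h₃ (hb L ι₁) emb cover wm Theta d12 d34).core V c).TΦ Φ v ≠ 0) →
          ((thetaModelOf hHD hI h₁ h₃ (hb L ι₁) emb cover wm Theta d12 d34).t34 V c).wOccurs i)) :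
    ∀ {L : CMField} {ι₁ : L →+* ℂ} (V : HermSpace3 L ι₁) (c : SeesawCtx L),
      (thetaModelOf hHD hI h₁ h₃ (hb L ι₁) emb cover wm Theta d12 d34).GoodCtx ι₁ c → scope c →
      (NumberField.InfinitePlace.mk ι₁).embedding = ι₁ →
      Nonempty ((picardCMUniverse hHD hI h₁ h₃).ThetaRealisation₂ ι₁ V c.K c.Ψ c.σ) :=
  Assembly.thetaRealisation₂_ofFunBridgesOG_S _ (Model.modelAxiomsPerL hHD hI h₃ h₁) hb (coreOf _ emb cover wm Theta) d12 d34 scope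
    innerEmb thetaSub thetaWedge gen12 real34 occ (Model.hodgeRiemann20 hHD hI h₃ h₁ hHR)

end Model
end HodgeCM

end
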